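/-
Copyright (c) 2026. All rights reserved.
Released under Apache 2.0 license as described in the file LICENSE.
Authors: abc-iut cell, campaign-S prover seat abc-iut-S1 (wave 1, gen 7).
-/
import Literature.IUT.LogVolume.UnitLogWildDyadicQuartic
import Literature.IUT.LogVolume.UnitLogUnramifiedDyadicArtinSchreier
import HarnessLib

/-!
# Dyadic places with `(e, f) = (4, 1)`: whether `log₂(𝒪_K^×)` meets `𝒪_K^×` is NOT a function of `(e, f)`

Proof-only sequel (theorems, no definitions) of `UnitLogWildDyadicQuartic.lean` (abc-iut-S1: `e = 4`,
`f = 1`, `‖ϖ₀⁴ − 2‖ ≤ ‖4‖` ⇒ `log₂(𝒪_K^×)` misses `𝒪_K^×`, e.g. `ℚ₂(⁴√2)`), closing the residual class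
`f = 1`, `4 ∣ e` of the cell's dyadic unit-logarithm census (abc-iut-w5-d172 / w5-d017:
`UnitLogWildDyadic`, `UnitLogRamificationCriterion`, `UnitLogWildDyadicInhabited/Empty`) in the only way
it can be closed: **at `(e, f) = (4, 1)` BOTH answers occur**, so at `p = 2` the question «is the `2`-adic
logarithm of some unit of `𝒪_K` a unit?» is not decided by the ramification index and the residue degree
(at odd `p` it is decided by `e` alone: `RamificationCriterion.logUnits_inter_sphere_nonempty_iff_dvd`).

* §1 **Witness lemma** (every `K/ℚ₂`): `u` a unit, `ζ` a root of unity, `‖ζ·u⁴ − 1‖ = ‖4‖` ⇒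
  `‖log₂ u‖ = 1` (`norm_unitLog_eq_one_of_norm_torsion_mul_pow_four_sub_one`): `4·log₂ u = log₂(ζu⁴)`
  and `L` is an isometry on `‖1 − y‖ = ‖4‖` (`norm_logSeries_eq_norm_four`).  Hence every fourth root
  `θ ∈ K` of a natural number `m ≡ 3, 5 (mod 8)` has a UNIT logarithm
  (`norm_unitLog_eq_one_of_pow_four_eq_natCast`; `θ⁴ = 3`: `−θ⁴ − 1 = −4`), whatever `K` is.
* §2 **Both classes occur inside `ℚ̄₂` at `(e, f) = (4, 1)`**: `ℚ₂(⁴√2)` is empty (the parent file) and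
  `ℚ₂(⁴√3)` is inhabited; `e(ℚ₂(⁴√3)/ℚ₂) = 4` because `(θ − 1)⁴ = 6θ² + 4(1 − θ − θ³)` has norm `‖2‖`
  (`exists_quartic_logUnits_inter_sphere_nonempty`).  HEADLINE: `exists_quartic_pair_empty_and_nonempty`.

Toward an exact criterion (recorded, not filed): by the witness lemma and the bijectivity of `log₂` between
`1 + 4𝒪_K` and `4𝒪_K`, `log₂(𝒪_K^×)` meets `𝒪_K^×` iff `μ(K)·(𝒪_K^×)⁴` meets the sphere `‖w − 1‖ = ‖4‖`.
Classical (Neukirch, *Algebraic Number Theory* II (5.5)).  Consumer: the cell's (Ind3) honest-model census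
([IUTchIII] Rmk. 1.1.1 (i), record only).  Nothing here is disputed mathematics; no IUT statement is
asserted; nothing bears on [IUTchIII] Cor. 3.12.
-/

noncomputable section

open Metric Set

namespace Literature.IUT.LogVolume

namespace WildDyadicQuartic

open Literature.NumberTheory.GaloisRepresentations.Ultrametric RamificationCriterion

variable {K : Type*} [NontriviallyNormedField K] [instK : NormedAlgebra ℚ_[2] K] [IsUltrametricDist K]
  [ProperSpace K]

/-! ### §0. Two private helpers (copies of the parent file's) -/

/-- `v₂(n) < n` for `n ≠ 0` (`v < 2^v ≤ n`). [folklore] -/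
private theorem padicValNat_two_lt_self {n : ℕ} (hn : n ≠ 0) : padicValNat 2 n < n :=
  Nat.lt_two_pow_self.trans_le (Nat.le_of_dvd (Nat.pos_of_ne_zero hn) pow_padicValNat_dvd)

omit instK [IsUltrametricDist K] [ProperSpace K] in
/-- Ultrametric bookkeeping: `‖a‖, ‖b‖ ≤ C ⇒ ‖a + b‖ ≤ C`. [folklore] -/
private theorem ultrametric_norm_add_le_of_le [IsUltrametricDist K] {a b : K} {C : ℝ} (ha : ‖a‖ ≤ C)
    (hb : ‖b‖ ≤ C) : ‖a + b‖ ≤ C :=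
  (IsUltrametricDist.norm_add_le_max a b).trans (max_le ha hb)

/-! ### §1. The witness lemma: `‖ζ·u⁴ − 1‖ = ‖4‖ ⇒ ‖log₂ u‖ = 1` -/

/-- **`L` is an isometry at radius `‖4‖`**: `‖1 − y‖ = ‖4‖ ⇒ ‖L(y)‖ = ‖4‖` (the index-`1` term has
exponent `2e`, every other index `m ≥ 2` has exponent `2e·m − e·v₂(m) ≥ 2e + 1`).
[cite: NeukirchANT1999, Ch. II (5.5)] -/
theorem norm_logSeries_eq_norm_four {y : K} (hy : ‖1 - y‖ = ‖(4 : K)‖) :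
    ‖logSeries y‖ = ‖(4 : K)‖ := by
  classical
  obtain ⟨ϖ, hϖ⟩ := exists_isUniformizer (F := K)
  have hρ0 : 0 < ‖(ϖ : K)‖ := norm_units_pos ϖ
  have he1 : 1 ≤ absRamificationIdx 2 K := absRamificationIdx_pos 2 K
  have h2 : ‖(2 : K)‖ = ‖(ϖ : K)‖ ^ absRamificationIdx 2 K := by
    exact_mod_cast norm_prime_eq_norm_pow 2 K hϖ
  have h4 : ‖(4 : K)‖ = ‖(ϖ : K)‖ ^ ((2 * absRamificationIdx 2 K : ℕ) : ℤ) := by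
    rw [show (4 : K) = 2 * 2 by norm_num, norm_mul, h2, zpow_natCast, ← pow_add, two_mul]
  have hy' : ‖1 - y‖ = ‖(ϖ : K)‖ ^ ((2 * absRamificationIdx 2 K : ℕ) : ℤ) := hy.trans h4
  have hyP : IsPrincipal y := by
    show ‖1 - y‖ < 1
    rw [hy, UnramifiedDyadic.norm_four]
    norm_num
  have h₀ : ((2 * absRamificationIdx 2 K : ℕ) : ℤ) * ((0 + 1 : ℕ) : ℤ)
      - (absRamificationIdx 2 K : ℤ) * (padicValNat 2 (0 + 1) : ℤ) = ((2 * absRamificationIdx 2 K : ℕ) : ℤ) := by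
    simp
  have hdom : ∀ n : ℕ, n ≠ 0 → ((2 * absRamificationIdx 2 K : ℕ) : ℤ) + 1
      ≤ ((2 * absRamificationIdx 2 K : ℕ) : ℤ) * ((n + 1 : ℕ) : ℤ)
        - (absRamificationIdx 2 K : ℤ) * (padicValNat 2 (n + 1) : ℤ) := by
    intro n hn
    have hv : padicValNat 2 (n + 1) < n + 1 := padicValNat_two_lt_self n.add_one_ne_zero
    have hv' : (padicValNat 2 (n + 1) : ℤ) ≤ n := by omega
    have he1' : (1 : ℤ) ≤ absRamificationIdx 2 K := by exact_mod_cast he1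
    have hn1 : (1 : ℤ) ≤ n := by omega
    have hprod : (1 : ℤ) ≤ (absRamificationIdx 2 K : ℤ) * (2 * (n : ℤ) - padicValNat 2 (n + 1)) :=
      one_le_mul_of_one_le_of_one_le he1' (by omega)
    push_cast
    nlinarith
  rw [norm_logSeries_eq_zpow_of_dominant 2 hϖ hyP hy' 0 h₀ hdom, ← h4]

/-- **Witness lemma.** If `u` is a unit, `ζ` a root of unity (`ζⁿ = 1`, `n ≥ 1`) and
`‖ζ·u⁴ − 1‖ = ‖4‖`, then **`‖log₂ u‖ = 1`**: `log₂(ζu⁴) = log₂ ζ + 4·log₂ u = 4·log₂ u` and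
`‖log₂(ζu⁴)‖ = ‖L(ζu⁴)‖ = ‖4‖` by the isometry. [cite: NeukirchANT1999, Ch. II (5.5)] -/
theorem norm_unitLog_eq_one_of_norm_torsion_mul_pow_four_sub_one {u ζ : K} (hu : ‖u‖ = 1) {n : ℕ}
    (hn : 0 < n) (hζ : ζ ^ n = 1) (h : ‖ζ * u ^ 4 - 1‖ = ‖(4 : K)‖) : ‖unitLog u‖ = 1 := by
  have hζ1 : ‖ζ‖ = 1 := by
    have h1 : ‖ζ‖ ^ n = 1 := by rw [← norm_pow, hζ, norm_one]
    exact (pow_eq_one_iff_of_nonneg (norm_nonneg ζ) hn.ne').mp h1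
  have hu4 : ‖u ^ 4‖ = 1 := by rw [norm_pow, hu, one_pow]
  have h4pos : 0 < ‖(4 : K)‖ := by rw [UnramifiedDyadic.norm_four]; norm_num
  have h1y : ‖1 - ζ * u ^ 4‖ = ‖(4 : K)‖ := by rw [norm_sub_rev, h]
  have hyP : IsPrincipal (ζ * u ^ 4) := by
    show ‖1 - ζ * u ^ 4‖ < 1
    rw [h1y, UnramifiedDyadic.norm_four]
    norm_num
  have hlog : unitLog (ζ * u ^ 4) = 4 * unitLog u := by
    rw [unitLog_mul 2 hζ1 hu4, unitLog_eq_zero_of_pow_eq_one 2 hn hζ, zero_add, unitLog_pow 2 hu 4]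
    push_cast
    ring
  have hnorm : ‖unitLog (ζ * u ^ 4)‖ = ‖(4 : K)‖ := by
    rw [unitLog_of_isPrincipal 2 hyP]
    exact norm_logSeries_eq_norm_four h1y
  rw [hlog, norm_mul] at hnorm
  exact (mul_eq_left₀ h4pos.ne').mp hnorm

omit [IsUltrametricDist K] [ProperSpace K] in
/-- `‖4·k‖ = ‖4‖` for `k` odd. [cite: NeukirchANT1999, Ch. II (5.5)] -/
private theorem norm_natCast_four_mul_odd {k : ℕ} (hk : ¬ 2 ∣ k) : ‖((4 * k : ℕ) : K)‖ = ‖(4 : K)‖ := by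
  push_cast
  rw [norm_mul, norm_natCast_eq_one_of_not_dvd 2 hk, mul_one]

/-- **Fourth roots of `m ≡ 3, 5 (mod 8)` have unit logarithms.** If `θ⁴ = m` in `K` with `m ≡ 5 (mod 8)`
(`‖θ⁴ − 1‖ = ‖m − 1‖ = ‖4‖`) or `m ≡ 3 (mod 8)` (`‖−θ⁴ − 1‖ = ‖m + 1‖ = ‖4‖`), then `‖log₂ θ‖ = 1` —
e.g. `⁴√3`, `⁴√5`, `⁴√11`, `⁴√13` in any `K ∋` them. [cite: NeukirchANT1999, Ch. II (5.5)] -/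
theorem norm_unitLog_eq_one_of_pow_four_eq_natCast {θ : K} {m : ℕ} (hθ : θ ^ 4 = m)
    (hm : m % 8 = 3 ∨ m % 8 = 5) : ‖unitLog θ‖ = 1 := by
  have hmodd : ¬ 2 ∣ m := by omega
  have hmK : ‖(m : K)‖ = 1 := norm_natCast_eq_one_of_not_dvd 2 hmodd
  have hθ1 : ‖θ‖ = 1 := by
    have h1 : ‖θ‖ ^ 4 = 1 := by rw [← norm_pow, hθ, hmK]
    exact (pow_eq_one_iff_of_nonneg (norm_nonneg θ) (by norm_num)).mp h1
  rcases hm with h3 | h5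
  · -- `m + 1 = 4·k`, `k` odd; take `ζ = −1`
    obtain ⟨k, hk⟩ : ∃ k, m + 1 = 4 * k := ⟨(m + 1) / 4, by omega⟩
    have hkodd : ¬ 2 ∣ k := by omega
    refine norm_unitLog_eq_one_of_norm_torsion_mul_pow_four_sub_one hθ1 (n := 2) two_pos
      (by norm_num : (-1 : K) ^ 2 = 1) ?_
    rw [hθ, show (-1 : K) * m - 1 = -((m + 1 : ℕ) : K) by push_cast; ring, norm_neg, hk]
    exact norm_natCast_four_mul_odd hkodd
  · -- `m − 1 = 4·k`, `k` odd; take `ζ = 1`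
    obtain ⟨k, hk⟩ : ∃ k, m = 4 * k + 1 := ⟨(m - 1) / 4, by omega⟩
    have hkodd : ¬ 2 ∣ k := by omega
    refine norm_unitLog_eq_one_of_norm_torsion_mul_pow_four_sub_one hθ1 (n := 1) one_pos
      (one_pow 1) ?_
    rw [hθ, one_mul, hk, show (((4 * k + 1 : ℕ) : K)) - 1 = ((4 * k : ℕ) : K) by push_cast; ring]
    exact norm_natCast_four_mul_odd hkodd

/-- **`θ⁴ = 3 ⇒ ‖log₂ θ‖ = 1`** (`−θ⁴ − 1 = −4`): in every `K ⊇ ℚ₂(⁴√3)` the logarithm of the unit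
`⁴√3` is a unit. [cite: NeukirchANT1999, Ch. II (5.5)] -/
theorem norm_unitLog_eq_one_of_pow_four_eq_three {θ : K} (hθ : θ ^ 4 = 3) : ‖unitLog θ‖ = 1 :=
  norm_unitLog_eq_one_of_pow_four_eq_natCast (m := 3) (by rw [hθ]; norm_cast) (Or.inl rfl)

/-- … so `log₂(𝒪_K^×)` MEETS the unit sphere as soon as `K` contains a fourth root of `3`.
[cite: NeukirchANT1999, Ch. II (5.5)] -/
theorem logUnits_inter_sphere_nonempty_of_pow_four_eq_three {θ : K} (hθ : θ ^ 4 = 3) :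
    (logUnits K ∩ sphere 0 1).Nonempty := by
  have h3 : ‖(3 : K)‖ = 1 := by exact_mod_cast norm_natCast_eq_one_of_not_dvd 2 (K := K) (m := 3) (by norm_num)
  have hθ1 : ‖θ‖ = 1 := by
    have h1 : ‖θ‖ ^ 4 = 1 := by rw [← norm_pow, hθ, h3]
    exact (pow_eq_one_iff_of_nonneg (norm_nonneg θ) (by norm_num)).mp h1
  exact ⟨unitLog θ, unitLog_mem_logUnits hθ1,
    mem_sphere_zero_iff_norm.mpr (norm_unitLog_eq_one_of_pow_four_eq_three hθ)⟩

/-! ### §2. Both classes occur inside `ℚ̄₂` at `(e, f) = (4, 1)` -/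

section AlgCl

open Polynomial IntermediateField

/-- A finite `E ⊆ ℚ̄₂` of degree `≤ 4` over `ℚ₂` containing an `x` with `‖x‖⁴ = 1/2` has `e = 4` and
`f = 1` (`‖x‖ ≤ 2^{−1/e}` forces `e ≥ 4`; `e·f ≤ 4`). [cite: NeukirchANT1999, Ch. II (5.5)] -/
theorem absRamificationIdx_eq_four_of_norm_pow_four (E : IntermediateField ℚ_[2] (PadicAlgCl 2))
    [FiniteDimensional ℚ_[2] E] (hdeg : Module.finrank ℚ_[2] E ≤ 4) {x : E} (hx : ‖x‖ ^ 4 = 2⁻¹) :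
    absRamificationIdx 2 E = 4 ∧ residueDegree 2 E = 1 := by
  have hef := absRamificationIdx_mul_residueDegree 2 (E : Type _)
  have hf := residueDegree_pos 2 (E : Type _)
  have hxlt : ‖x‖ < 1 :=
    (pow_lt_one_iff_of_nonneg (norm_nonneg _) (by norm_num : (4 : ℕ) ≠ 0)).mp (by rw [hx]; norm_num)
  have hdisc := norm_le_rpow_of_norm_lt_one 2 (E : Type _) hxlt
  set e := absRamificationIdx 2 E with hedef
  have he0 : (0 : ℝ) < e := by exact_mod_cast absRamificationIdx_pos 2 (E : Type _)
  have h4 : ‖x‖ ^ 4 ≤ ((2 : ℝ) ^ (-(1 / (e : ℝ)))) ^ 4 := pow_le_pow_left₀ (norm_nonneg _) hdisc 4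
  rw [hx, ← Real.rpow_natCast, ← Real.rpow_mul (by norm_num), ← Real.rpow_neg_one,
    Real.rpow_le_rpow_left_iff (by norm_num : (1 : ℝ) < 2)] at h4
  have hege : (4 : ℝ) ≤ e := by
    have h := mul_le_mul_of_nonneg_right h4 he0.le
    field_simp at h
    push_cast at h
    nlinarith
  have hege' : 4 ≤ e := by exact_mod_cast hege
  have hprod : e * residueDegree 2 E ≤ 4 := hef.trans_le hdeg
  constructor
  · nlinarith
  · nlinarith

/-- **`ℚ₂(⁴√2) ⊆ ℚ̄₂` has `e = 4`, `f = 1`, and `log₂(𝒪^×)` MISSES the unit sphere** (`ϖ₀ = ⁴√2`,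
`‖ϖ₀⁴ − 2‖ = 0`). [cite: NeukirchANT1999, Ch. II (5.5)] -/
theorem exists_quartic_logUnits_inter_sphere_eq_empty :
    ∃ (E : IntermediateField ℚ_[2] (PadicAlgCl 2)) (_ : FiniteDimensional ℚ_[2] E),
      absRamificationIdx 2 E = 4 ∧ residueDegree 2 E = 1 ∧ logUnits E ∩ sphere 0 1 = ∅ := by
  obtain ⟨α, hα⟩ := IsAlgClosed.exists_pow_nat_eq (2 : PadicAlgCl 2) (by norm_num : 0 < 4)
  have h2 : algebraMap ℚ_[2] (PadicAlgCl 2) 2 = 2 := map_ofNat _ 2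
  have heval : Polynomial.aeval α (X ^ 4 - C (2 : ℚ_[2])) = 0 := by
    simp [hα, h2]
  have hint : IsIntegral ℚ_[2] α := ⟨X ^ 4 - C 2, monic_X_pow_sub_C 2 (by norm_num), by
    simpa [Polynomial.aeval_def] using heval⟩
  haveI hfd : FiniteDimensional ℚ_[2] ℚ_[2]⟮α⟯ := adjoin.finiteDimensional hint
  have hπ : (⟨α, mem_adjoin_simple_self ℚ_[2] α⟩ : ℚ_[2]⟮α⟯) ^ 4 = 2 := by
    apply Subtype.ext
    have h2E : ((2 : ℚ_[2]⟮α⟯) : PadicAlgCl 2) = 2 := map_ofNat (algebraMap ℚ_[2]⟮α⟯ (PadicAlgCl 2)) 2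
    simp [hα, h2E]
  set π : ℚ_[2]⟮α⟯ := ⟨α, mem_adjoin_simple_self ℚ_[2] α⟩ with hπdef
  have hdeg : Module.finrank ℚ_[2] ℚ_[2]⟮α⟯ ≤ 4 := by
    rw [adjoin.finrank hint]
    have hdvd : minpoly ℚ_[2] α ∣ X ^ 4 - C 2 := minpoly.dvd ℚ_[2] α heval
    have hne : (X ^ 4 - C (2 : ℚ_[2])) ≠ 0 := (monic_X_pow_sub_C 2 (by norm_num)).ne_zero
    calc (minpoly ℚ_[2] α).natDegree ≤ (X ^ 4 - C (2 : ℚ_[2])).natDegree := natDegree_le_of_dvd hdvd hne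
      _ = 4 := natDegree_X_pow_sub_C
  have hnorm : ‖π‖ ^ 4 = 2⁻¹ := by
    rw [← norm_pow, hπ]
    exact WildDyadic.norm_two
  obtain ⟨he, hf⟩ := absRamificationIdx_eq_four_of_norm_pow_four ℚ_[2]⟮α⟯ hdeg hnorm
  refine ⟨ℚ_[2]⟮α⟯, hfd, he, hf, logUnits_inter_sphere_eq_empty_of_four he hf (ϖ₀ := π) ?_⟩
  rw [hπ, sub_self, norm_zero]
  exact norm_nonneg _

/-- **`ℚ₂(⁴√3) ⊆ ℚ̄₂` has `e = 4`, `f = 1`, and `log₂(𝒪^×)` MEETS the unit sphere** (`θ = ⁴√3`: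
`(θ − 1)⁴ = 6θ² + 4(1 − θ − θ³)` has norm `‖2‖`, so `e = 4`; `‖log₂ θ‖ = 1` by §1).
[cite: NeukirchANT1999, Ch. II (5.5)] -/
theorem exists_quartic_logUnits_inter_sphere_nonempty :
    ∃ (E : IntermediateField ℚ_[2] (PadicAlgCl 2)) (_ : FiniteDimensional ℚ_[2] E),
      absRamificationIdx 2 E = 4 ∧ residueDegree 2 E = 1 ∧ (logUnits E ∩ sphere 0 1).Nonempty := by
  obtain ⟨β, hβ⟩ := IsAlgClosed.exists_pow_nat_eq (3 : PadicAlgCl 2) (by norm_num : 0 < 4)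
  have h3 : algebraMap ℚ_[2] (PadicAlgCl 2) 3 = 3 := map_ofNat _ 3
  have heval : Polynomial.aeval β (X ^ 4 - C (3 : ℚ_[2])) = 0 := by
    simp [hβ, h3]
  have hint : IsIntegral ℚ_[2] β := ⟨X ^ 4 - C 3, monic_X_pow_sub_C 3 (by norm_num), by
    simpa [Polynomial.aeval_def] using heval⟩
  haveI hfd : FiniteDimensional ℚ_[2] ℚ_[2]⟮β⟯ := adjoin.finiteDimensional hint
  have hθ : (⟨β, mem_adjoin_simple_self ℚ_[2] β⟩ : ℚ_[2]⟮β⟯) ^ 4 = 3 := by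
    apply Subtype.ext
    have h3E : ((3 : ℚ_[2]⟮β⟯) : PadicAlgCl 2) = 3 := map_ofNat (algebraMap ℚ_[2]⟮β⟯ (PadicAlgCl 2)) 3
    simp [hβ, h3E]
  set θ : ℚ_[2]⟮β⟯ := ⟨β, mem_adjoin_simple_self ℚ_[2] β⟩ with hθdef
  have hdeg : Module.finrank ℚ_[2] ℚ_[2]⟮β⟯ ≤ 4 := by
    rw [adjoin.finrank hint]
    have hdvd : minpoly ℚ_[2] β ∣ X ^ 4 - C 3 := minpoly.dvd ℚ_[2] β heval
    have hne : (X ^ 4 - C (3 : ℚ_[2])) ≠ 0 := (monic_X_pow_sub_C 3 (by norm_num)).ne_zero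
    calc (minpoly ℚ_[2] β).natDegree ≤ (X ^ 4 - C (3 : ℚ_[2])).natDegree := natDegree_le_of_dvd hdvd hne
      _ = 4 := natDegree_X_pow_sub_C
  -- `‖θ − 1‖⁴ = 1/2`
  have h3n : ‖(3 : ℚ_[2]⟮β⟯)‖ = 1 := by
    exact_mod_cast norm_natCast_eq_one_of_not_dvd 2 (K := ℚ_[2]⟮β⟯) (m := 3) (by norm_num)
  have hθ1 : ‖θ‖ = 1 := by
    have h1 : ‖θ‖ ^ 4 = 1 := by rw [← norm_pow, hθ, h3n]
    exact (pow_eq_one_iff_of_nonneg (norm_nonneg θ) (by norm_num)).mp h1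
  have hid : (θ - 1) ^ 4 = 6 * θ ^ 2 + 4 * (1 - θ - θ ^ 3) := by
    have hexp : (θ - 1) ^ 4 = θ ^ 4 - 4 * θ ^ 3 + 6 * θ ^ 2 - 4 * θ + 1 := by ring
    rw [hexp, hθ]
    ring
  have h6 : ‖(6 : ℚ_[2]⟮β⟯) * θ ^ 2‖ = 2⁻¹ := by
    rw [norm_mul, show (6 : ℚ_[2]⟮β⟯) = 2 * 3 by norm_num, norm_mul, WildDyadic.norm_two, h3n, norm_pow,
      hθ1]
    norm_num
  have hsmall : ‖(4 : ℚ_[2]⟮β⟯) * (1 - θ - θ ^ 3)‖ ≤ 4⁻¹ := by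
    rw [norm_mul, UnramifiedDyadic.norm_four]
    have h1 : ‖1 - θ - θ ^ 3‖ ≤ 1 := by
      rw [show (1 : ℚ_[2]⟮β⟯) - θ - θ ^ 3 = 1 + (-θ + -(θ ^ 3)) by ring]
      refine ultrametric_norm_add_le_of_le (by rw [norm_one]) (ultrametric_norm_add_le_of_le ?_ ?_)
      · rw [norm_neg, hθ1]
      · rw [norm_neg, norm_pow, hθ1, one_pow]
    calc (4⁻¹ : ℝ) * ‖1 - θ - θ ^ 3‖ ≤ 4⁻¹ * 1 := by gcongr
      _ = 4⁻¹ := mul_one _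
  have hnorm : ‖θ - 1‖ ^ 4 = 2⁻¹ := by
    rw [← norm_pow, hid]
    have hlt : ‖(4 : ℚ_[2]⟮β⟯) * (1 - θ - θ ^ 3)‖ < ‖(6 : ℚ_[2]⟮β⟯) * θ ^ 2‖ := by
      rw [h6]
      exact hsmall.trans_lt (by norm_num)
    rw [IsUltrametricDist.norm_add_eq_max_of_norm_ne_norm (ne_of_gt hlt), max_eq_left hlt.le, h6]
  obtain ⟨he, hf⟩ := absRamificationIdx_eq_four_of_norm_pow_four ℚ_[2]⟮β⟯ hdeg hnorm
  exact ⟨ℚ_[2]⟮β⟯, hfd, he, hf, logUnits_inter_sphere_nonempty_of_pow_four_eq_three hθ⟩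

/-- **HEADLINE.  At `p = 2`, whether `log₂(𝒪_K^×)` meets `𝒪_K^×` is NOT a function of `(e, f)`:** there are
finite `E₁, E₂ ⊆ ℚ̄₂`, both with `e = 4` and `f = 1` (namely `ℚ₂(⁴√2)` and `ℚ₂(⁴√3)`), such that
`log₂(𝒪_{E₁}^×) ∩ 𝒪_{E₁}^× = ∅` while `log₂(𝒪_{E₂}^×) ∩ 𝒪_{E₂}^× ≠ ∅`.  (At odd `p` it IS a function of
`e` alone: `RamificationCriterion.logUnits_inter_sphere_nonempty_iff_dvd`.)
[cite: NeukirchANT1999, Ch. II (5.5)] -/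
theorem exists_quartic_pair_empty_and_nonempty :
    ∃ (E₁ E₂ : IntermediateField ℚ_[2] (PadicAlgCl 2)) (_ : FiniteDimensional ℚ_[2] E₁)
      (_ : FiniteDimensional ℚ_[2] E₂),
      absRamificationIdx 2 E₁ = 4 ∧ residueDegree 2 E₁ = 1 ∧
        absRamificationIdx 2 E₂ = 4 ∧ residueDegree 2 E₂ = 1 ∧
        logUnits E₁ ∩ sphere 0 1 = ∅ ∧ (logUnits E₂ ∩ sphere 0 1).Nonempty := by
  obtain ⟨E₁, h₁, he₁, hf₁, hE₁⟩ := exists_quartic_logUnits_inter_sphere_eq_empty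
  obtain ⟨E₂, h₂, he₂, hf₂, hE₂⟩ := exists_quartic_logUnits_inter_sphere_nonempty
  exact ⟨E₁, E₂, h₁, h₂, he₁, hf₁, he₂, hf₂, hE₁, hE₂⟩

end AlgCl

end WildDyadicQuartic

end Literature.IUT.LogVolume

end
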